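import Mathlib.Data.Real.Basic
import Mathlib.Tactic.NormNum
import Mathlib.Tactic.Linarith
import Mathlib.Tactic.Positivity
import Mathlib.Analysis.Real.Pi.Bounds
import Literature.MathematicalPhysics.QuantumFieldTheory.AoyamaEtAl2025.SetVDeterminations
import Literature.MathematicalPhysics.QuantumFieldTheory.Volkov2024.ClassesWithLeptonLoops
import HarnessLib

/-!
# WP25 §8.1–§8.4 (Phys. Rept. 1143 (2025) 1–158): the tenth-order QED coefficient A₁⁽¹⁰⁾ after the 2025 resolution of the
# AHKN–Volkov Set V discrepancy — the jointly authored consensus numbers, as printed, with kernel arithmetic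

CITATION HEADER (venture `QEDPrecision`, cells `pub-qed` / `qed-hepp`; human ruling D-0043 asked whether the A₁⁽¹⁰⁾ discrepancy is
"still open in print"). A typed PUBLISHED headline-number sheet: every value is a Monte-Carlo estimate of its authors with the printed
1σ, or a measured / derived constant as printed; the kernel checks ARITHMETIC between printed numbers only — no physics is asserted and
no statement about which determination is right is made or implied. Only TOTALS over the tenth-order gauge sets appear (no per-family
or per-diagram Set V value: the cells' blinding protocol is untouched).

Source: R. Aliberti et al. (Muon g−2 Theory Initiative), "The anomalous magnetic moment of the muon in the Standard Model: an update",
Phys. Rept. 1143 (2025) 1–158, doi:10.1016/j.physrep.2025.08.002 = arXiv:2505.21476 [AlibertiEtAl2025]; §8 "The QED contributions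
to a_μ" is signed "T. Aoyama, M. Hayakawa, M. Nio, S. Volkov" (lit store `paper:arxiv-2505.21476`, LaTeX-derived chunks p0113–p0118;
locators `[chunk:Lnn]`). VERBATIM (LaTeX expanded):
* §8.1 [p0114:L77–L93]: "α⁻¹(Cs) = 137.035 999 045(27) [0.20 ppb], α⁻¹(Rb) = 137.035 999 2052(97) [0.071 ppb] …
  α⁻¹(Cs) − α⁻¹(Rb) = −0.160(29) × 10⁻⁶, corresponding to a significance of 5.5σ."
* §8.2 [p0114:L101–L102; p0115:L12–L23]: "a_e^exp(NW22) = 1 159 652 180.59(13) × 10⁻¹² [0.11 ppb]"; "α⁻¹(a_e) = 137.035 999 163(15)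
  [0.11 ppb], which is smaller than the value reported in Ref. [Fan:2022eto] by 3 × 10⁻⁹. This shift … is attributed to two factors. The
  first is a 13 % reduction of the tenth-order QED term of a_e … The total uncertainty is entirely driven by the measurement …, while
  the uncertainties from the QED tenth-order term and the hadronic contributions are 0.44 × 10⁻⁹ and 0.36 × 10⁻⁸, respectively."
  [p0115:L28–L33]: "α⁻¹(Cs) − α⁻¹(a_e) = −0.118(31) × 10⁻⁶, α⁻¹(Rb) − α⁻¹(a_e) = +0.042(18) × 10⁻⁶, corresponding to −3.8σ and +2.3σ".
* §8.3 [p0115:L63–L88; p0116:L1–L27]: "In Ref. [Volkov:2019phy] and successively in Ref. [Volkov:2024yzc], the contribution to A₁⁽¹⁰⁾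
  from Set V, which consists of 6,354 vertex diagrams without a fermion loop, was obtained using numerical integration. … The best
  estimate is then obtained by statistically combining both results: A₁⁽¹⁰⁾[Set V: Volkov] = 6.828(60). This exhibited a 5σ
  discrepancy from the latest report 7.668(159) given in Ref. [Aoyama:2019ryr] by AHKN, which was used to determine the QED contribution
  to a_μ in WP20. … The 98 integrals representing these 98 groups were then reevaluated by Monte-Carlo integration with substantially
  increased statistics. … AHKN's tenth-order contribution has been updated to A₁⁽¹⁰⁾[Set V: AHKN] = 6.800(128), which is in good
  agreement with [Volkov's]. … A₁⁽¹⁰⁾[with fermion loops: Volkov] = −0.9377(35). The corresponding AHKN value … A₁⁽¹⁰⁾[with fermion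
  loops: AHKN] = −0.9304(36), which is larger … by 0.0073(50), indicating good agreement between the two. The mass-independent and
  universal A₁⁽¹⁰⁾ terms of Volkov and AHKN then become A₁⁽¹⁰⁾[all: Volkov] = 5.891(61), A₁⁽¹⁰⁾[all: AHKN] = 5.870(128). Since they are
  in good agreement and independent, the weighted average of the two determinations gives the best estimate A₁⁽¹⁰⁾ = 5.887(55)".
* §8.4 [p0116:L50; L74–L93]: "the difference of 1.35 × 10⁻¹² arising from the discrepancy between the two theoretical predictions of a_e
  caused by the two values of α"; "a_e^SM[α(Cs)] = 1 159 652 181.59 (23)(0)(3) × 10⁻¹² [0.20 ppb], a_e^SM[α(Rb)] = 1 159 652 180.238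
  (82)(4)(30) × 10⁻¹² [0.075 ppb], where the uncertainties, listed from left to right, correspond to the fine-structure constant α, the
  tenth-order QED term A₁⁽¹⁰⁾, and the hadronic contributions. … a_e^exp(NW22) − a_e^SM[α(Cs)] = −1.00(26) × 10⁻¹²,
  a_e^exp(NW22) − a_e^SM[α(Rb)] = +0.35(16) × 10⁻¹², corresponding to −3.8σ and +2.2σ, respectively."

Contents and kernel facts (`norm_num` / `decide +kernel`; one real-analysis lemma uses Mathlib's `Real.pi_gt_d6` / `Real.pi_lt_d6`):
* the printed pairs `setVVolkov … consensus : Volkov2024.PV`, the α⁻¹ and a_e values (a_e in units of 10⁻¹² with the printed split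
  uncertainties as a small structure `AeSM`), and the printed differences.
* CROSS-FILE: `setV_eq_AoyamaEtAl2025` — the two Set V numbers and the quoted "latest report 7.668(159)" ARE PRD 111, L031902's
  eqs. (8), (9), (3) (`AoyamaEtAl2025.eq8/eq9/eq3`), value and uncertainty; `volkov_eq_Volkov2024` — Volkov's fermion-loop part and total
  ARE PRD 110, 036001's Table I TOTAL (Average column) and its eq. (3) (`Volkov2024.tableI_total.average`, `Volkov2024.totalVolkov`).
  (AHKN's −0.9304(36) is PRD 97, 036001 (2018)'s number as WP25 cites it; PRD 110 quotes AHKN's loop part as −0.933(17) =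
  `Volkov2024.ahknWithLeptonLoops` — both typed, not reconciled here: `loopsAHKN_vs_volkovQuote`.)
* ARITHMETIC (central values and printed σ's only): `totals_eq_setV_add_loops` (6.828 − 0.9377 = 5.8903 vs 5.891; 6.800 − 0.9304 =
  5.8696 vs 5.870; quadrature σ's 0.0601 / 0.1281 vs printed 0.061 / 0.128); `loops_difference` (−0.9304 + 0.9377 = 0.0073 exactly,
  `0.0050² < 0.0035² + 0.0036² < 0.00505²`); `consensus_is_inverse_variance_mean` (weighted mean of 5.891(61) and 5.870(128) = 5.8871…,
  σ² = 1/(1/0.061² + 1/0.128²) ∈ (0.055², 0.0551²)); `setV_discrepancy_2019` ("5σ": `4.9² < sigSq 7.668(159) vs 6.828(60) < 5.0²`);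
  `setV_agreement_2025` (Δ = −0.028, `sigSq < 1/25`; totals Δ = −0.021, `sigSq < 1/40`); `thirteen_percent` (the pre-2025 AHKN total
  6.737(159) — `Volkov2024.totalAHKN`, = 7.668 − 0.9304 to 10⁻³ — down to 5.887 is a reduction by a fraction in (0.126, 0.127));
  `ae_differences` and `alpha_differences` (the printed differences and their σ's are the quadrature combinations of the printed inputs
  to the printed digits; 1.35 = a_e^SM[Cs] − a_e^SM[Rb] = 1.352); and ONE labelled unit conversion `ae_tenthOrder_uncertainty`: with
  α = 1/137.035 999 163 and `3.141592 < π < 3.141593`, `σ(A₁⁽¹⁰⁾)·(α/π)⁵ = 0.055·(α/π)⁵ ∈ (3.5, 4.0) × 10⁻¹⁵` — the printed "(4)" (units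
  10⁻¹⁵) of a_e^SM[α(Rb)]'s second uncertainty and the "(0)" (units 10⁻¹⁴) of a_e^SM[α(Cs)]'s (multiplying the coefficient's σ by the
  expansion parameter's fifth power is the definition of the series term's uncertainty at fixed α; nothing else is used).
Deliberately NOT here: a_μ numbers (§8.5), the HVP/HLbL/EW inputs of §8.4, Kitano's lattice estimate 7.0 ± 0.9 (PTEP 2025, a different
source), CODATA-2022's pre-resolution 6.08(16), and any judgement beyond the quoted sentences.
-/

namespace Literature.MathematicalPhysics.QuantumFieldTheory.AlibertiEtAl2025

open Volkov2024 (PV)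
open AoyamaEtAl2025 (sigSq)

/-! ## §8.3 — the printed A₁⁽¹⁰⁾ numbers -/

/-- "A₁⁽¹⁰⁾[Set V: Volkov] = 6.828(60)" (statistical combination of PRD 100, 096004 and PRD 110, 036001).
[cite: AlibertiEtAl2025, §8.3 (chunk p0115:L63–L68)] -/
def setVVolkov : PV := ⟨6.828, 0.060⟩

/-- "This exhibited a 5σ discrepancy from the latest report 7.668(159) given in Ref. [Aoyama:2019ryr] by AHKN, which was used to
determine the QED contribution to a_μ in WP20" — the superseded AHKN 2019 Set V value as quoted. [cite: AlibertiEtAl2025, §8.3 (p0115:L72–L73)] -/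
def setVAHKN2019 : PV := ⟨7.668, 0.159⟩

/-- "AHKN's tenth-order contribution has been updated to A₁⁽¹⁰⁾[Set V: AHKN] = 6.800(128), which is in good agreement with
[A₁⁽¹⁰⁾[Set V: Volkov]]". [cite: AlibertiEtAl2025, §8.3 (p0115:L81–L88)] -/
def setVAHKN : PV := ⟨6.800, 0.128⟩

/-- "A₁⁽¹⁰⁾[with fermion loops: Volkov] = −0.9377(35)" (the 6,318 diagrams with at least one fermion loop, PRD 110, 036001).
[cite: AlibertiEtAl2025, §8.3 (p0116:L1–L5)] -/
def loopsVolkov : PV := ⟨-0.9377, 0.0035⟩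

/-- "The corresponding AHKN value was first reported in Ref. [Aoyama:2012wj] and updated in Ref. [Aoyama:2017uqe]:
A₁⁽¹⁰⁾[with fermion loops: AHKN] = −0.9304(36)". [cite: AlibertiEtAl2025, §8.3 (p0116:L9–L12)] -/
def loopsAHKN : PV := ⟨-0.9304, 0.0036⟩

/-- "… which is larger than [Volkov's] by 0.0073(50), indicating good agreement between the two."
[cite: AlibertiEtAl2025, §8.3 (p0116:L16)] -/
def loopsDiff : PV := ⟨0.0073, 0.0050⟩

/-- "A₁⁽¹⁰⁾[all: Volkov] = 5.891(61)". [cite: AlibertiEtAl2025, §8.3 (p0116:L17–L20)] -/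
def totalVolkov : PV := ⟨5.891, 0.061⟩

/-- "A₁⁽¹⁰⁾[all: AHKN] = 5.870(128)". [cite: AlibertiEtAl2025, §8.3 (p0116:L21)] -/
def totalAHKN : PV := ⟨5.870, 0.128⟩

/-- "Since they are in good agreement and independent, the weighted average of the two determinations gives the best estimate
A₁⁽¹⁰⁾ = 5.887(55)". [cite: AlibertiEtAl2025, §8.3 (p0116:L24–L27)] -/
def consensus : PV := ⟨5.887, 0.055⟩

/-! ## §8.1–§8.2 — α and a_e^exp as printed -/

/-- "α⁻¹(Cs) = 137.035 999 045(27) [0.20 ppb]". [cite: AlibertiEtAl2025, §8.1 (p0114:L78)] -/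
def alphaInvCs : PV := ⟨137.035999045, 0.000000027⟩

/-- "α⁻¹(Rb) = 137.035 999 2052(97) [0.071 ppb]". [cite: AlibertiEtAl2025, §8.1 (p0114:L79)] -/
def alphaInvRb : PV := ⟨137.0359992052, 0.0000000097⟩

/-- "α⁻¹(a_e) = 137.035 999 163(15) [0.11 ppb]". [cite: AlibertiEtAl2025, §8.2 (p0115:L13)] -/
def alphaInvAe : PV := ⟨137.035999163, 0.000000015⟩

/-- "… the uncertainties from the QED tenth-order term and the hadronic contributions are 0.44 × 10⁻⁹ and 0.36 × 10⁻⁸" (on α⁻¹(a_e)):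
the tenth-order one. [cite: AlibertiEtAl2025, §8.2 (p0115:L21–L23)] -/
def alphaInvAe_uncA10 : ℚ := 0.44e-9

/-- idem, the hadronic one, `0.36 × 10⁻⁸`. [cite: AlibertiEtAl2025, §8.2 (p0115:L21–L23)] -/
def alphaInvAe_uncHad : ℚ := 0.36e-8

/-- "α⁻¹(Cs) − α⁻¹(Rb) = −0.160(29) × 10⁻⁶ … 5.5σ"; "α⁻¹(Cs) − α⁻¹(a_e) = −0.118(31) × 10⁻⁶, α⁻¹(Rb) − α⁻¹(a_e) = +0.042(18) × 10⁻⁶,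
corresponding to −3.8σ and +2.3σ" — the three printed differences (units of 1). [cite: AlibertiEtAl2025, §8.1 (p0114:L90), §8.2 (p0115:L28–L33)] -/
def alphaDiffs : PV × PV × PV := (⟨-0.160e-6, 0.029e-6⟩, ⟨-0.118e-6, 0.031e-6⟩, ⟨0.042e-6, 0.018e-6⟩)

/-- "a_e^exp(NW22) = 1 159 652 180.59(13) × 10⁻¹² [0.11 ppb]" — typed in units of 10⁻¹². [cite: AlibertiEtAl2025, §8.2 (p0114:L102)] -/
def aeExp : PV := ⟨1159652180.59, 0.13⟩

/-! ## §8.4 — a_e^SM with the printed split uncertainties -/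

/-- A printed a_e^SM line "value (u_α)(u_A10)(u_had) × 10⁻¹²": value and the three uncertainties in units of 10⁻¹², the parentheticals
converted to absolute units of the last printed digit. [cite: AlibertiEtAl2025, §8.4 (p0116:L77–L84)] -/
structure AeSM where
  /-- central value, units 10⁻¹². -/
  val : ℚ
  /-- first parenthetical: "the fine-structure constant α". -/
  uncAlpha : ℚ
  /-- second parenthetical: "the tenth-order QED term A₁⁽¹⁰⁾". -/
  uncA10 : ℚ
  /-- third parenthetical: "the hadronic contributions". -/
  uncHad : ℚ
  deriving DecidableEq

/-- "a_e^SM[α(Cs)] = 1 159 652 181.59 (23)(0)(3) × 10⁻¹² [0.20 ppb]" (last digit = 10⁻¹⁴; the tenth-order entry is printed "(0)").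
[cite: AlibertiEtAl2025, §8.4 (p0116:L78)] -/
def aeSMCs : AeSM := ⟨1159652181.59, 0.23, 0, 0.03⟩

/-- "a_e^SM[α(Rb)] = 1 159 652 180.238 (82)(4)(30) × 10⁻¹² [0.075 ppb]" (last digit = 10⁻¹⁵). [cite: AlibertiEtAl2025, §8.4 (p0116:L80)] -/
def aeSMRb : AeSM := ⟨1159652180.238, 0.082, 0.004, 0.030⟩

/-- "a_e^exp(NW22) − a_e^SM[α(Cs)] = −1.00(26) × 10⁻¹², a_e^exp(NW22) − a_e^SM[α(Rb)] = +0.35(16) × 10⁻¹², corresponding to −3.8σ and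
+2.2σ". [cite: AlibertiEtAl2025, §8.4 (p0116:L86–L93)] -/
def aeDiffs : PV × PV := (⟨-1.00, 0.26⟩, ⟨0.35, 0.16⟩)

/-- "the difference of 1.35 × 10⁻¹² arising from the discrepancy between the two theoretical predictions of a_e caused by the two values
of α". [cite: AlibertiEtAl2025, §8.4 (p0116:L50)] -/
def aeSM_alphaSpread : ℚ := 1.35

/-! ## Cross-file identifications (the consensus numbers ARE the two groups' own printed numbers) -/

/-- The WP25 Set V pair and the quoted 2019 value are PRD 111, L031902's eq. (8) "A₁⁽¹⁰⁾[Set V: Volkov, combined] = 6.828 (60)",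
eq. (9) "A₁⁽¹⁰⁾[Set V: AHKN2024] = 6.800 (128)" and eq. (3) "A₁⁽¹⁰⁾[Set V: AHKN2019] = 7.668 (159)", value and uncertainty.
[cite: AlibertiEtAl2025, §8.3] [cite: AoyamaEtAl2025, §I eqs. (3), (8), (9)] -/
theorem setV_eq_AoyamaEtAl2025 :
    setVVolkov = AoyamaEtAl2025.eq8 ∧ setVAHKN = AoyamaEtAl2025.eq9 ∧ setVAHKN2019 = AoyamaEtAl2025.eq3 := by
  decide +kernel

/-- Volkov's fermion-loop part and total are PRD 110, 036001's Table I TOTAL (Average column) "−0.9377(35)" and its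
"A₁⁽¹⁰⁾[Volkov] = 5.891(61)". [cite: AlibertiEtAl2025, §8.3] [cite: Volkov2024, Table I, p. 3] -/
theorem volkov_eq_Volkov2024 :
    loopsVolkov = Volkov2024.tableI_total.average ∧ totalVolkov = Volkov2024.totalVolkov := by
  decide +kernel

/-- The two typed quotations of AHKN's fermion-loop part differ in print: WP25's "−0.9304(36)" (from PRD 97, 036001) vs PRD 110,
036001's quotation "−0.933(17)" (`Volkov2024.ahknWithLeptonLoops`): central values `0.0026` apart, quoted σ's `0.0036` vs `0.017`.
Recorded, not reconciled. [cite: AlibertiEtAl2025, §8.3 (p0116:L9–L12)] [cite: Volkov2024, p. 3] -/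
theorem loopsAHKN_vs_volkovQuote :
    loopsAHKN.val - Volkov2024.ahknWithLeptonLoops.val = 0.0026 ∧
    loopsAHKN.err = 0.0036 ∧ Volkov2024.ahknWithLeptonLoops.err = 0.017 := by
  refine ⟨?_, ?_, ?_⟩ <;> norm_num [loopsAHKN, Volkov2024.ahknWithLeptonLoops]

/-! ## Arithmetic of the printed numbers -/

/-- "then become": each total is its Set V part plus its fermion-loop part to the printed digits — `6.828 − 0.9377 = 5.8903` vs
`5.891`, `6.800 − 0.9304 = 5.8696` vs `5.870` (each `|Δ| < 10⁻³`); the quadrature σ's satisfy `0.0601² < 0.060² + 0.0035² < 0.0602²`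
(printed total σ `0.061`, Volkov's own) and `0.128² < 0.128² + 0.0036² < 0.1281²` (printed `0.128`). [cite: AlibertiEtAl2025, §8.3 (p0116:L17–L21)] -/
theorem totals_eq_setV_add_loops :
    setVVolkov.val + loopsVolkov.val = 5.8903 ∧ |setVVolkov.val + loopsVolkov.val - totalVolkov.val| < 1e-3 ∧
    setVAHKN.val + loopsAHKN.val = 5.8696 ∧ |setVAHKN.val + loopsAHKN.val - totalAHKN.val| < 1e-3 ∧
    (0.0601 : ℚ) ^ 2 < setVVolkov.err ^ 2 + loopsVolkov.err ^ 2 ∧ setVVolkov.err ^ 2 + loopsVolkov.err ^ 2 < (0.0602 : ℚ) ^ 2 ∧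
    totalAHKN.err ^ 2 < setVAHKN.err ^ 2 + loopsAHKN.err ^ 2 ∧ setVAHKN.err ^ 2 + loopsAHKN.err ^ 2 < (0.1281 : ℚ) ^ 2 := by
  refine ⟨?_, ?_, ?_, ?_, ?_, ?_, ?_, ?_⟩
  · norm_num [setVVolkov, loopsVolkov]
  · rw [abs_lt]; constructor <;> norm_num [setVVolkov, loopsVolkov, totalVolkov]
  · norm_num [setVAHKN, loopsAHKN]
  · rw [abs_lt]; constructor <;> norm_num [setVAHKN, loopsAHKN, totalAHKN]
  · norm_num [setVVolkov, loopsVolkov]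
  · norm_num [setVVolkov, loopsVolkov]
  · norm_num [setVAHKN, loopsAHKN, totalAHKN]
  · norm_num [setVAHKN, loopsAHKN]

/-- "larger … by 0.0073(50)": `−0.9304 − (−0.9377) = 0.0073` exactly and `0.0050² < 0.0035² + 0.0036² < 0.00505²`; in units of the
combined σ the squared difference is `< 2.2` ("good agreement"). [cite: AlibertiEtAl2025, §8.3 (p0116:L16)] -/
theorem loops_difference :
    loopsAHKN.val - loopsVolkov.val = loopsDiff.val ∧
    loopsDiff.err ^ 2 < loopsVolkov.err ^ 2 + loopsAHKN.err ^ 2 ∧ loopsVolkov.err ^ 2 + loopsAHKN.err ^ 2 < (0.00505 : ℚ) ^ 2 ∧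
    sigSq loopsAHKN loopsVolkov < 2.2 := by
  refine ⟨?_, ?_, ?_, ?_⟩ <;> norm_num [loopsAHKN, loopsVolkov, loopsDiff, sigSq]

/-- "the weighted average of the two determinations gives the best estimate A₁⁽¹⁰⁾ = 5.887(55)": the inverse-variance mean of
`5.891(61)` and `5.870(128)` is `5.8871…` (`|mean − 5.887| < 5·10⁻⁴`) with variance `1/(1/0.061² + 1/0.128²) ∈ (0.055², 0.0551²)`.
[cite: AlibertiEtAl2025, §8.3 (p0116:L24–L27)] -/
theorem consensus_is_inverse_variance_mean :
    |(totalVolkov.val / totalVolkov.err ^ 2 + totalAHKN.val / totalAHKN.err ^ 2) /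
        (1 / totalVolkov.err ^ 2 + 1 / totalAHKN.err ^ 2) - consensus.val| < 5e-4 ∧
    consensus.err ^ 2 < 1 / (1 / totalVolkov.err ^ 2 + 1 / totalAHKN.err ^ 2) ∧
    1 / (1 / totalVolkov.err ^ 2 + 1 / totalAHKN.err ^ 2) < (0.0551 : ℚ) ^ 2 := by
  refine ⟨?_, ?_, ?_⟩
  · rw [abs_lt]; constructor <;> norm_num [totalVolkov, totalAHKN, consensus]
  · norm_num [totalVolkov, totalAHKN, consensus]
  · norm_num [totalVolkov, totalAHKN]

/-- "This exhibited a 5σ discrepancy from the latest report 7.668(159)": `7.668 − 6.828 = 0.840` and, in units of the two printed σ's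
in quadrature, `4.9² < sigSq < 5.0²` (`√ = 4.94`). [cite: AlibertiEtAl2025, §8.3 (p0115:L72)] -/
theorem setV_discrepancy_2019 :
    setVAHKN2019.val - setVVolkov.val = 0.840 ∧
    (4.9 : ℚ) ^ 2 < sigSq setVAHKN2019 setVVolkov ∧ sigSq setVAHKN2019 setVVolkov < (5.0 : ℚ) ^ 2 := by
  refine ⟨?_, ?_, ?_⟩ <;> norm_num [setVAHKN2019, setVVolkov, sigSq]

/-- "in good agreement" (Set V) / "in good agreement and independent" (totals): the updated AHKN Set V value lies `0.028` BELOW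
Volkov's with `sigSq < 1/25` (i.e. `< 0.2σ` in the quadrature-combined printed σ `0.141`); the totals differ by `−0.021` with
`sigSq < 1/40`. [cite: AlibertiEtAl2025, §8.3 (p0115:L88, p0116:L24)] -/
theorem setV_agreement_2025 :
    setVAHKN.val - setVVolkov.val = -0.028 ∧ sigSq setVAHKN setVVolkov < 1 / 25 ∧
    (0.141 : ℚ) ^ 2 < setVAHKN.err ^ 2 + setVVolkov.err ^ 2 ∧ setVAHKN.err ^ 2 + setVVolkov.err ^ 2 < (0.142 : ℚ) ^ 2 ∧
    totalAHKN.val - totalVolkov.val = -0.021 ∧ sigSq totalAHKN totalVolkov < 1 / 40 := by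
  refine ⟨?_, ?_, ?_, ?_, ?_, ?_⟩ <;> norm_num [setVAHKN, setVVolkov, totalAHKN, totalVolkov, sigSq]

/-- "a 13 % reduction of the tenth-order QED term of a_e": from the pre-2025 AHKN total `6.737(159)` (PRD 110, 036001's quotation of
Atoms 7, 28, `Volkov2024.totalAHKN`; it is `7.668 − 0.9304 = 6.7376` to `10⁻³`, the WP20 input per §8.3) down to `5.887` is a relative
reduction in `(0.126, 0.127)`. [cite: AlibertiEtAl2025, §8.2 (p0115:L17), §8.3] [cite: Volkov2024, p. 3] -/
theorem thirteen_percent :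
    |setVAHKN2019.val + loopsAHKN.val - Volkov2024.totalAHKN.val| < 1e-3 ∧
    (0.126 : ℚ) < (Volkov2024.totalAHKN.val - consensus.val) / Volkov2024.totalAHKN.val ∧
    (Volkov2024.totalAHKN.val - consensus.val) / Volkov2024.totalAHKN.val < (0.127 : ℚ) := by
  refine ⟨?_, ?_, ?_⟩
  · rw [abs_lt]; constructor <;> norm_num [setVAHKN2019, loopsAHKN, Volkov2024.totalAHKN]
  · norm_num [Volkov2024.totalAHKN, consensus]
  · norm_num [Volkov2024.totalAHKN, consensus]

/-- The printed α⁻¹ differences are the differences of the printed α⁻¹ values (`−0.1602`, `−0.118`, `+0.0422`, × 10⁻⁶, to the printed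
digits) and their σ's are the quadrature sums to the printed digits (`0.0287`, `0.0309`, `0.0179` × 10⁻⁶); significances: `5.5² <
sigSq(Cs,Rb) < 5.6²`, `3.8² < sigSq(Cs,a_e) < 3.9²`, `2.3² < sigSq(Rb,a_e) < 2.4²`. [cite: AlibertiEtAl2025, §8.1 (p0114:L90–L93), §8.2 (p0115:L28–L33)] -/
theorem alpha_differences :
    alphaInvCs.val - alphaInvRb.val = -0.1602e-6 ∧ alphaInvCs.val - alphaInvAe.val = -0.118e-6 ∧
    alphaInvRb.val - alphaInvAe.val = 0.0422e-6 ∧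
    |alphaInvCs.val - alphaInvRb.val - alphaDiffs.1.val| < 5e-10 ∧ |alphaInvRb.val - alphaInvAe.val - alphaDiffs.2.2.val| < 5e-10 ∧
    (0.0285e-6 : ℚ) ^ 2 < alphaInvCs.err ^ 2 + alphaInvRb.err ^ 2 ∧ alphaInvCs.err ^ 2 + alphaInvRb.err ^ 2 < (0.029e-6 : ℚ) ^ 2 ∧
    (0.0305e-6 : ℚ) ^ 2 < alphaInvCs.err ^ 2 + alphaInvAe.err ^ 2 ∧ alphaInvCs.err ^ 2 + alphaInvAe.err ^ 2 < (0.031e-6 : ℚ) ^ 2 ∧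
    (0.0175e-6 : ℚ) ^ 2 < alphaInvRb.err ^ 2 + alphaInvAe.err ^ 2 ∧ alphaInvRb.err ^ 2 + alphaInvAe.err ^ 2 < (0.018e-6 : ℚ) ^ 2 ∧
    (5.5 : ℚ) ^ 2 < sigSq alphaInvCs alphaInvRb ∧ sigSq alphaInvCs alphaInvRb < (5.6 : ℚ) ^ 2 ∧
    (3.8 : ℚ) ^ 2 < sigSq alphaInvCs alphaInvAe ∧ sigSq alphaInvCs alphaInvAe < (3.9 : ℚ) ^ 2 ∧
    (2.3 : ℚ) ^ 2 < sigSq alphaInvRb alphaInvAe ∧ sigSq alphaInvRb alphaInvAe < (2.4 : ℚ) ^ 2 := by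
  refine ⟨?_, ?_, ?_, ?_, ?_, ?_, ?_, ?_, ?_, ?_, ?_, ?_, ?_, ?_, ?_, ?_, ?_⟩ <;>
    norm_num [alphaInvCs, alphaInvRb, alphaInvAe, alphaDiffs, sigSq]

/-- The printed a_e differences are `a_e^exp − a_e^SM` of the printed values (`−1.00` exactly, `0.352` vs printed `0.35`) and their σ's
are the quadrature sums of the printed experimental σ and the three printed theory σ's (`0.2655² < Σ < 0.2665²` vs "(26)";
`0.156² < Σ < 0.157²` vs "(16)"); squared significances `(−1.00)²/Σσ² ∈ (3.7², 3.9²)` (printed "−3.8σ") and `0.352²/Σσ² ∈ (2.2², 2.3²)`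
(printed "+2.2σ"); and "1.35 × 10⁻¹²" is `a_e^SM[Cs] − a_e^SM[Rb] = 1.352`. [cite: AlibertiEtAl2025, §8.4 (p0116:L50, L86–L93)] -/
theorem ae_differences :
    aeExp.val - aeSMCs.val = aeDiffs.1.val ∧ aeExp.val - aeSMRb.val = 0.352 ∧ |aeExp.val - aeSMRb.val - aeDiffs.2.val| < 5e-3 ∧
    (0.2655 : ℚ) ^ 2 < aeExp.err ^ 2 + aeSMCs.uncAlpha ^ 2 + aeSMCs.uncA10 ^ 2 + aeSMCs.uncHad ^ 2 ∧
    aeExp.err ^ 2 + aeSMCs.uncAlpha ^ 2 + aeSMCs.uncA10 ^ 2 + aeSMCs.uncHad ^ 2 < (0.2665 : ℚ) ^ 2 ∧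
    (0.156 : ℚ) ^ 2 < aeExp.err ^ 2 + aeSMRb.uncAlpha ^ 2 + aeSMRb.uncA10 ^ 2 + aeSMRb.uncHad ^ 2 ∧
    aeExp.err ^ 2 + aeSMRb.uncAlpha ^ 2 + aeSMRb.uncA10 ^ 2 + aeSMRb.uncHad ^ 2 < (0.157 : ℚ) ^ 2 ∧
    (3.7 : ℚ) ^ 2 < (aeExp.val - aeSMCs.val) ^ 2 / (aeExp.err ^ 2 + aeSMCs.uncAlpha ^ 2 + aeSMCs.uncA10 ^ 2 + aeSMCs.uncHad ^ 2) ∧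
    (aeExp.val - aeSMCs.val) ^ 2 / (aeExp.err ^ 2 + aeSMCs.uncAlpha ^ 2 + aeSMCs.uncA10 ^ 2 + aeSMCs.uncHad ^ 2) < (3.9 : ℚ) ^ 2 ∧
    (2.2 : ℚ) ^ 2 < (aeExp.val - aeSMRb.val) ^ 2 / (aeExp.err ^ 2 + aeSMRb.uncAlpha ^ 2 + aeSMRb.uncA10 ^ 2 + aeSMRb.uncHad ^ 2) ∧
    (aeExp.val - aeSMRb.val) ^ 2 / (aeExp.err ^ 2 + aeSMRb.uncAlpha ^ 2 + aeSMRb.uncA10 ^ 2 + aeSMRb.uncHad ^ 2) < (2.3 : ℚ) ^ 2 ∧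
    aeSMCs.val - aeSMRb.val = 1.352 ∧ |aeSMCs.val - aeSMRb.val - aeSM_alphaSpread| < 5e-3 := by
  refine ⟨?_, ?_, ?_, ?_, ?_, ?_, ?_, ?_, ?_, ?_, ?_, ?_, ?_⟩ <;>
    norm_num [aeExp, aeSMCs, aeSMRb, aeDiffs, aeSM_alphaSpread]

/-! ## The one unit conversion: σ(A₁⁽¹⁰⁾) · (α/π)⁵ in units of a_e -/

/-- The expansion parameter `α/π` with the printed `α⁻¹(a_e) = 137.035 999 163` (any of the three printed α's gives the same five
leading digits of `(α/π)⁵`; this choice is bookkeeping). [cite: AlibertiEtAl2025, §8.2 (p0115:L13), §8.3 eq. for `A_i = Σ (α/π)ⁿ A_i⁽²ⁿ⁾` (p0115:L45–L49)] -/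
noncomputable def alphaOverPi : ℝ := 1 / ((alphaInvAe.val : ℝ) * Real.pi)

/-- With `3.141592 < π < 3.141593` (Mathlib): `0.0023228 < α/π < 0.0023229`. [cite: AlibertiEtAl2025, §8.2–§8.3] -/
theorem alphaOverPi_bounds : (0.0023228 : ℝ) < alphaOverPi ∧ alphaOverPi < (0.0023229 : ℝ) := by
  have hpi₁ := Real.pi_gt_d6
  have hpi₂ := Real.pi_lt_d6
  have hA : (alphaInvAe.val : ℝ) = 137.035999163 := by norm_num [alphaInvAe]
  unfold alphaOverPi
  rw [hA]
  have hden : (0 : ℝ) < 137.035999163 * Real.pi := by positivity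
  constructor
  · rw [lt_div_iff₀ hden]
    nlinarith
  · rw [div_lt_iff₀ hden]
    nlinarith

/-- THE LABELLED CONVERSION: the consensus uncertainty `σ(A₁⁽¹⁰⁾) = 0.055` times `(α/π)⁵` lies in `(3.5 × 10⁻¹⁵, 4.0 × 10⁻¹⁵)` —
it rounds to the printed second parenthetical "(4)" (units 10⁻¹⁵) of `a_e^SM[α(Rb)]` and is below half of the last digit (10⁻¹⁴) of
`a_e^SM[α(Cs)]`, printed "(0)". Only the product of two printed numbers and Mathlib's π bounds are used.
[cite: AlibertiEtAl2025, §8.3 (p0116:L27), §8.4 (p0116:L78–L84)] -/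
theorem ae_tenthOrder_uncertainty :
    (3.5e-15 : ℝ) < (consensus.err : ℝ) * alphaOverPi ^ 5 ∧ (consensus.err : ℝ) * alphaOverPi ^ 5 < (4.0e-15 : ℝ) ∧
    (aeSMRb.uncA10 : ℝ) * 1e-12 = 4e-15 ∧ aeSMCs.uncA10 = 0 ∧ (4.0e-15 : ℝ) < (1 / 2) * 1e-14 := by
  obtain ⟨h₁, h₂⟩ := alphaOverPi_bounds
  have hc : (consensus.err : ℝ) = 0.055 := by norm_num [consensus]
  have h0 : (0 : ℝ) ≤ alphaOverPi := le_of_lt (lt_trans (by norm_num) h₁)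
  have hlo : (0.0023228 : ℝ) ^ 5 < alphaOverPi ^ 5 := pow_lt_pow_left₀ h₁ (by norm_num) (by norm_num)
  have hhi : alphaOverPi ^ 5 < (0.0023229 : ℝ) ^ 5 := pow_lt_pow_left₀ h₂ h0 (by norm_num)
  refine ⟨?_, ?_, ?_, ?_, ?_⟩
  · rw [hc]; nlinarith
  · rw [hc]; nlinarith
  · norm_num [aeSMRb]
  · rfl
  · norm_num

end Literature.MathematicalPhysics.QuantumFieldTheory.AlibertiEtAl2025
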